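import Summits.HubbardSuperconductivity.HubbardSuperconductivity.Theorems.LiebTwinNoOnsiteODLROGainDominance
import Summits.HubbardSuperconductivity.HubbardSuperconductivity.Theorems.LiebTwinNoOnsiteODLROPseudospinCeiling
import HarnessLib

/-!
# Line `supermodular-gain` for crux `NoOnsiteODLRO` (stmt-HubbardSuperconductivity-0933)

Crux-strategist r1 (redirect), 2026-08-17. LEVER: the two-parameter sector ground energy
`E_{L,N}(U,c) := minEnergyOn (hubbardTorus 2 L 1 U − c·P_sᴴP_s) (szSector N 0)` is SUPERMODULAR on
`[0,∞) × [0,∞)`: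
`E(U₂,c₁) + E(U₁,c₂) ≤ E(U₂,c₂) + E(U₁,c₁)` for `U₁ ≤ U₂`, `c₁ ≤ c₂`
("repulsion and the on-site BCS field are complements": the reduced-BCS gain `E(U,0) − E(U,c)` is
non-increasing in `U`; equivalently the maximal ground-state on-site pair structure factor is
non-increasing in `U`, INCLUDING alignment at ground-state level crossings; equivalently, thermally,
the Duhamel covariance of the doublon number and `P_sᴴP_s` is `≥ 0` — a Griffiths-II inequality for
the pair field). Instantiated at `(U₁,c₁) = (0,0)` it is FREE GAIN DOMINANCE WITH ZERO SLACK, and the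
landed socket `GainDominance.noOnsiteODLRO_of_freeGainDominance` (free side closed by
`free_reducedGain_le`, on-site secant `smul_re_expect_le_minEnergyOn_sub`) turns it into the crux —
indeed with the optimal rate `S_L = O(L²)`.

EVIDENCE (kit jobs j026724, j026726, j026739, attached to the item): exact supermodularity holds with
ZERO violations on every cluster tested (tori/ladders/rings, 4–16 sites, all fillings, `U ∈ [0,16]`,
`c ∈ [0,0.8]`, open and closed shells, degenerate ground spaces), for the thermal free energy at every
`β`, AND for RANDOM real-symmetric hopping matrices on 4–7 sites (class A, >200 samples, all fillings):
the inequality appears to be GRAPH-INDEPENDENT linear algebra of the triple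
`(dΓ(T)⊗1 + 1⊗dΓ(T), Σ_x n_{x↑}n_{x↓}, η₀†η₀)`, not band-structure physics — which is why it is a
strategy short of the summit (census F1's objection does not apply to a universally true inequality).

Stub: `stub_gainSupermodular` (torus form; the ONLY obligation of `NoOnsiteODLRO_of`); transfer target
`PairGainSupermodularGraph` (a `def … : Prop`: every finite simple graph, every hopping `t`, pair operator
`η₀†η₀`, `η₀ = etaLower 1`) with `NoOnsiteODLRO_of_graph : PairGainSupermodularGraph → crux` PROVED
(`c ↦ 2c` by `P_s = −√2 η₀`).
-/

noncomputable section

set_option linter.dupNamespace false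
set_option linter.unusedVariables false

namespace Summit.HubbardSuperconductivity.HubbardSuperconductivity.Cruxes.NoOnsiteODLRO.SupermodularGain

open Matrix Literature.Probability.LatticeModels Literature.MathematicalPhysics.QuantumLattice
open scoped ComplexOrder

/-! ### Stub 1 (core, torus form): supermodularity of the reduced-BCS-perturbed sector energy -/

/-- **STUB (core).** For every side `L`, every sector `(N, S^z = 0)` and `0 ≤ U₁ ≤ U₂`, `0 ≤ c₁ ≤ c₂`:
`E(U₂,c₁) + E(U₁,c₂) ≤ E(U₂,c₂) + E(U₁,c₁)` where
`E(U,c) = minEnergyOn (hubbardTorus 2 L 1 U − c·P_sᴴP_s) (szSector N 0)`, `P_s = pairField sWave L`.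
Griffiths, Phys. Rev. 152 (1966) 240 §II (the classical prototype); conjectured here (ED: kit j026724/26/39). -/
theorem stub_gainSupermodular :
    ∀ (L : ℕ) [NeZero L] (N : ℕ) (U₁ U₂ c₁ c₂ : ℝ), 0 ≤ U₁ → U₁ ≤ U₂ → 0 ≤ c₁ → c₁ ≤ c₂ →
      (hubbardTorus 2 L 1 U₂ - (c₁ : ℂ) • ((pairField sWave L)ᴴ * pairField sWave L)).minEnergyOn
            (szSector (Λ := FermionTorus 2 L) N 0) +
          (hubbardTorus 2 L 1 U₁ - (c₂ : ℂ) • ((pairField sWave L)ᴴ * pairField sWave L)).minEnergyOn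
            (szSector (Λ := FermionTorus 2 L) N 0) ≤
        (hubbardTorus 2 L 1 U₂ - (c₂ : ℂ) • ((pairField sWave L)ᴴ * pairField sWave L)).minEnergyOn
            (szSector (Λ := FermionTorus 2 L) N 0) +
          (hubbardTorus 2 L 1 U₁ - (c₁ : ℂ) • ((pairField sWave L)ᴴ * pairField sWave L)).minEnergyOn
            (szSector (Λ := FermionTorus 2 L) N 0) := by
  sorry

/-! ### Transfer target (general graph): the same inequality for every finite Hubbard graph -/

/-- **TRANSFER TARGET `C⁺` (general-graph form; a named conjecture, deliberately NOT a sorried stub so that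
the registered skeleton has exactly one obligation).** For every finite simple graph `G` on a finite
linearly ordered vertex type, every hopping `t`, every sector `(N, S^z = 0)` and `0 ≤ U₁ ≤ U₂`,
`0 ≤ c₁ ≤ c₂`, the sector ground energy of `hamiltonian G t U − c·η₀ᴴη₀` (`η₀ = etaLower 1`, the
unstaggered on-site pair annihilator) is supermodular in `(U,c)`. Numerically it even holds for random
real-symmetric hopping MATRICES with random potentials (kit j026739 classes A/B, 428/428; j026788: true
exactly on `U ≥ 0`): a statement of finite-dimensional matrix analysis. It implies the core stub
(`gainSupermodular_of_graph`, PROVED: `hubbardTorus 2 L t U = hamiltonian (fermionTorusGraph 2 L) t U`,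
`P_s = −√2·η₀`, so `c ↦ 2c`). Griffiths (1966) §II; Lieb, PRL 62 (1989) 1201 (the `W`-matrix
representation: `D = Σ_x ‖A_x W A_xᵀ‖²`, `η₀ᴴη₀ = ‖Σ_x A_x W A_xᵀ‖²`). [folklore] -/
def PairGainSupermodularGraph : Prop :=
  ∀ (Λ : Type) [LinearOrder Λ] [Fintype Λ] (G : SimpleGraph Λ) [DecidableRel G.Adj] (t : ℝ) (N : ℕ)
    (U₁ U₂ c₁ c₂ : ℝ), 0 ≤ U₁ → U₁ ≤ U₂ → 0 ≤ c₁ → c₁ ≤ c₂ →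
    (hamiltonian G t U₂ - (c₁ : ℂ) •
          ((etaLower (fun _ : Λ => (1 : ℤˣ)))ᴴ * etaLower (fun _ : Λ => (1 : ℤˣ)))).minEnergyOn
          (szSector (Λ := Λ) N 0) +
        (hamiltonian G t U₁ - (c₂ : ℂ) •
          ((etaLower (fun _ : Λ => (1 : ℤˣ)))ᴴ * etaLower (fun _ : Λ => (1 : ℤˣ)))).minEnergyOn
          (szSector (Λ := Λ) N 0) ≤
      (hamiltonian G t U₂ - (c₂ : ℂ) •
          ((etaLower (fun _ : Λ => (1 : ℤˣ)))ᴴ * etaLower (fun _ : Λ => (1 : ℤˣ)))).minEnergyOn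
          (szSector (Λ := Λ) N 0) +
        (hamiltonian G t U₁ - (c₁ : ℂ) •
          ((etaLower (fun _ : Λ => (1 : ℤˣ)))ᴴ * etaLower (fun _ : Λ => (1 : ℤˣ)))).minEnergyOn
          (szSector (Λ := Λ) N 0)

/-! ### Transfer: the general-graph stub implies the torus core (`P_s = -√2·η₀`, `c ↦ 2c`) -/

/-- `P_sᴴ P_s = 2 · η₀ᴴ η₀` on the torus (`P_s = pairField sWave L = -√2 η₀`, `η₀ = etaLower 1`).
Scalapino, Phys. Rep. 250 (1995) 329, §2; Yang, PRL 63 (1989) 2144. [folklore] -/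
theorem pairField_sWave_conjTranspose_mul_self (L : ℕ) [NeZero L] :
    (pairField sWave L)ᴴ * pairField sWave L =
      ((2 : ℝ) : ℂ) • ((etaLower (fun _ : FermionTorus 2 L => (1 : ℤˣ)))ᴴ *
        etaLower (fun _ : FermionTorus 2 L => (1 : ℤˣ))) := by
  rw [Summit.HubbardSuperconductivity.HubbardSuperconductivity.Theorems.TwSeededEnsembleEquivalence.ExposedDensity.etaTower_pairField_sWave_eq L,
    conjTranspose_smul, Matrix.smul_mul, Matrix.mul_smul, smul_smul]
  congr 1
  rw [star_neg, Complex.star_def, Complex.conj_ofReal, neg_mul_neg, ← Complex.ofReal_mul,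
    Real.mul_self_sqrt zero_le_two]

/-- The perturbed torus Hamiltonian in general-graph clothes. [folklore] -/
theorem hubbardTorus_sub_smul_eq (L : ℕ) [NeZero L] (U c : ℝ) :
    hubbardTorus 2 L 1 U - (c : ℂ) • ((pairField sWave L)ᴴ * pairField sWave L) =
      hamiltonian (fermionTorusGraph 2 L) 1 U - ((2 * c : ℝ) : ℂ) •
        ((etaLower (fun _ : FermionTorus 2 L => (1 : ℤˣ)))ᴴ *
          etaLower (fun _ : FermionTorus 2 L => (1 : ℤˣ))) := by
  rw [pairField_sWave_conjTranspose_mul_self, smul_smul, ← Complex.ofReal_mul, mul_comm c 2]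
  rfl

/-- **Transfer.** The general-graph supermodularity gives the torus core (instantiate at the torus
graph, hopping `1`, couplings `2c₁ ≤ 2c₂`). [folklore] -/
theorem gainSupermodular_of_graph (h : PairGainSupermodularGraph) :
    ∀ (L : ℕ) [NeZero L] (N : ℕ) (U₁ U₂ c₁ c₂ : ℝ), 0 ≤ U₁ → U₁ ≤ U₂ → 0 ≤ c₁ → c₁ ≤ c₂ →
      (hubbardTorus 2 L 1 U₂ - (c₁ : ℂ) • ((pairField sWave L)ᴴ * pairField sWave L)).minEnergyOn
            (szSector (Λ := FermionTorus 2 L) N 0) +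
          (hubbardTorus 2 L 1 U₁ - (c₂ : ℂ) • ((pairField sWave L)ᴴ * pairField sWave L)).minEnergyOn
            (szSector (Λ := FermionTorus 2 L) N 0) ≤
        (hubbardTorus 2 L 1 U₂ - (c₂ : ℂ) • ((pairField sWave L)ᴴ * pairField sWave L)).minEnergyOn
            (szSector (Λ := FermionTorus 2 L) N 0) +
          (hubbardTorus 2 L 1 U₁ - (c₁ : ℂ) • ((pairField sWave L)ᴴ * pairField sWave L)).minEnergyOn
            (szSector (Λ := FermionTorus 2 L) N 0) := by
  intro L _ N U₁ U₂ c₁ c₂ h₁ h₂ h₃ h₄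
  simp only [hubbardTorus_sub_smul_eq]
  exact h (FermionTorus 2 L) (fermionTorusGraph 2 L) 1 N U₁ U₂ (2 * c₁) (2 * c₂) h₁ h₂ (by linarith)
    (by linarith)

/-! ### Composition: the core stub closes the crux through the landed energy-form socket -/

/-- **Composition with the stub as an explicit hypothesis** (conclusion = the body of
`Theses.LiebTwin.NoOnsiteODLRO` = `Theses.EnslavedA1g.NoOnsiteODLRO`, verbatim, so that the only theorems
concluding the crux DECL are the hypothesis-free ones below). Instantiate supermodularity at the corner
`(U₁,c₁) = (0,0)`, `(U₂,c₂) = (U, g/L²)`: the reduced-BCS gain of the repulsive torus is at most the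
FREE gas's gain (zero slack) — the hypothesis of `GainDominance.noOnsiteODLRO_of_freeGainDominance` with
any `η > 0`. [folklore] -/
theorem NoOnsiteODLRO_of_stubs
    (hSM : ∀ (L : ℕ) [NeZero L] (N : ℕ) (U₁ U₂ c₁ c₂ : ℝ), 0 ≤ U₁ → U₁ ≤ U₂ → 0 ≤ c₁ → c₁ ≤ c₂ →
      (hubbardTorus 2 L 1 U₂ - (c₁ : ℂ) • ((pairField sWave L)ᴴ * pairField sWave L)).minEnergyOn
            (szSector (Λ := FermionTorus 2 L) N 0) +
          (hubbardTorus 2 L 1 U₁ - (c₂ : ℂ) • ((pairField sWave L)ᴴ * pairField sWave L)).minEnergyOn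
            (szSector (Λ := FermionTorus 2 L) N 0) ≤
        (hubbardTorus 2 L 1 U₂ - (c₂ : ℂ) • ((pairField sWave L)ᴴ * pairField sWave L)).minEnergyOn
            (szSector (Λ := FermionTorus 2 L) N 0) +
          (hubbardTorus 2 L 1 U₁ - (c₁ : ℂ) • ((pairField sWave L)ᴴ * pairField sWave L)).minEnergyOn
            (szSector (Λ := FermionTorus 2 L) N 0)) :
    ∀ (U δ : ℝ), 0 < U → δ ∈ Set.Ioo (0 : ℝ) (1 / 2) →
      ∀ (N : ℕ → ℕ) (ψ : ∀ L, Fock (Orb (FermionTorus 2 L))),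
        (∀ L, Even L → N L = 2 * ⌊(1 - δ) * (L : ℝ) ^ 2 / 2⌋₊ ∧ star (ψ L) ⬝ᵥ ψ L = 1 ∧
            IsGroundStateInSector (hubbardTorus 2 L 1 U) (N L) 0 (ψ L)) →
          ∀ ε : ℝ, 0 < ε → ∃ L₀ : ℕ, ∀ (L : ℕ) [NeZero L], Even L → L₀ ≤ L →
            (expect (Matrix.conjTranspose (pairField sWave L) * pairField sWave L) (ψ L)).re / (L : ℝ) ^ 4 ≤ ε := by
  have hcrux : Summit.HubbardSuperconductivity.HubbardSuperconductivity.Theses.LiebTwin.NoOnsiteODLRO := by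
    refine Summit.HubbardSuperconductivity.HubbardSuperconductivity.Theorems.NoOnsiteODLRO.GainDominance.noOnsiteODLRO_of_freeGainDominance ?_
    intro U δ hU hδ g hg η hη
    refine ⟨1, fun L _ _ _ => ?_⟩
    have hc : (0 : ℝ) ≤ g / (L : ℝ) ^ 2 := by positivity
    have h := hSM L (2 * ⌊(1 - δ) * (L : ℝ) ^ 2 / 2⌋₊) 0 U 0 (g / (L : ℝ) ^ 2) le_rfl hU.le le_rfl hc
    simp only [Complex.ofReal_zero, zero_smul, sub_zero] at h
    have hη' : (0 : ℝ) ≤ η * (L : ℝ) ^ 2 := by positivity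
    linarith
  exact hcrux

/-- **`NoOnsiteODLRO_of`** — the crux decl BY NAME (`EnslavedA1g` copy = the skeleton's `crux_decl`) from the
registered stub `stub_gainSupermodular`; no hypotheses. [folklore] -/
theorem NoOnsiteODLRO_of :
    Summit.HubbardSuperconductivity.HubbardSuperconductivity.Theses.EnslavedA1g.NoOnsiteODLRO :=
  NoOnsiteODLRO_of_stubs (fun L _ N U₁ U₂ c₁ c₂ h₁ h₂ h₃ h₄ =>
    stub_gainSupermodular L N U₁ U₂ c₁ c₂ h₁ h₂ h₃ h₄)

/-- The crux by name, `LiebTwin` copy (`Iff.rfl` with the above). [folklore] -/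
theorem NoOnsiteODLRO_proof :
    Summit.HubbardSuperconductivity.HubbardSuperconductivity.Theses.LiebTwin.NoOnsiteODLRO :=
  NoOnsiteODLRO_of_stubs (fun L _ N U₁ U₂ c₁ c₂ h₁ h₂ h₃ h₄ =>
    stub_gainSupermodular L N U₁ U₂ c₁ c₂ h₁ h₂ h₃ h₄)

/-- **The crux (body) from the general-graph conjecture** (transfer target ⇒ core ⇒ crux). [folklore] -/
theorem NoOnsiteODLRO_of_graph (h : PairGainSupermodularGraph) :
    ∀ (U δ : ℝ), 0 < U → δ ∈ Set.Ioo (0 : ℝ) (1 / 2) →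
      ∀ (N : ℕ → ℕ) (ψ : ∀ L, Fock (Orb (FermionTorus 2 L))),
        (∀ L, Even L → N L = 2 * ⌊(1 - δ) * (L : ℝ) ^ 2 / 2⌋₊ ∧ star (ψ L) ⬝ᵥ ψ L = 1 ∧
            IsGroundStateInSector (hubbardTorus 2 L 1 U) (N L) 0 (ψ L)) →
          ∀ ε : ℝ, 0 < ε → ∃ L₀ : ℕ, ∀ (L : ℕ) [NeZero L], Even L → L₀ ≤ L →
            (expect (Matrix.conjTranspose (pairField sWave L) * pairField sWave L) (ψ L)).re / (L : ℝ) ^ 4 ≤ ε :=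
  NoOnsiteODLRO_of_stubs (gainSupermodular_of_graph h)

end Summit.HubbardSuperconductivity.HubbardSuperconductivity.Cruxes.NoOnsiteODLRO.SupermodularGain
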